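import Summits.CriticalPhenomena.PercolationContinuityZ3.Theorems.PercNearOneGluingNoHeavyLowerTailSahiE3UnionTensor
import Literature.Combinatorics.Sahi2008.Functional
import Mathlib.Tactic.Linarith
import Mathlib.Tactic.Ring
import HarnessLib

/-!
# `NoHeavyLowerTail` (crux stmt-CriticalPhenomena-4575), Sahi programme P4: `E₃ ≥ 0` for UNIONS of independent triples — measure level

Support file (cell `prim-l12`, seat P4, generation 32; `--supports stmt-CriticalPhenomena-4575`).  No definitions, no named facts, no sorries;
standard axioms.  Companion of `…SahiE3UnionTensor` (the algebraic core `e3Union_nonneg_of_failMoments`).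

THEOREM `sahiE_three_por_nonneg`.  Let `μ`, `ν` be probability weights on finite types `γ`, `β` and `a_0,a_1,a_2 : γ → [0,1]`,
`b_0,b_1,b_2 : β → [0,1]`.  Assume on each side the three Harris rows `E[a_i]E[a_j] ≤ E[a_ia_j]`, the three hereditary Harris rows
`E[a_ia_j]E[a_k] ≤ E[a_0a_1a_2]` and Sahi's row `E₃(a_0,a_1,a_2) ≥ 0` (tree's `sahiE μ 3 a`, [Sahi2008, p. 213; LiebSahi2021, (2.1)]).  Then under the
product weight `(x,y) ↦ μ(x)ν(y)` the "probabilistic OR" slots `u_i(x,y) = a_i(x) + b_i(y) − a_i(x)b_i(y)` satisfy `E₃(u_0,u_1,u_2) ≥ 0`.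
For indicators `a_i = 1_{A_i}`, `b_i = 1_{B_i}` the slot `u_i` is the indicator of `(A_i × β) ∪ (γ × B_i)`: **member-wise unions of two independent
triples of events that are Kahn–Sahi-positive up to order 3 (with the hereditary pair×single Harris rows) are again `E₃`-nonnegative** — the OR
companion of the AND tensorisation `SahiTotalCumulance.sahiE_prod_tensor_nonneg'` (for AND the law-level statement is FALSE without heredity,
ttrl cp-mix MIXCOMB §8.1; for OR it holds, ibid. §8.3, here with a short structural proof).  For increasing events / monotone functions on FKG spaces
all rows but `E₃ ≥ 0` are Harris' inequality, so Sahi's `C₃` (= Kahn's Conjecture 5 on that space) passes from `(X, μ)` and `(Y, ν)` to all triples of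
"rectangle unions" on `X × Y` (lattice corollary in a further companion).  HONEST FRAMING: a closure theorem; `C₃` itself is not claimed. [this work]
-/

namespace Summit.CriticalPhenomena.PercolationContinuityZ3.Theorems.SahiE3UnionTensor

open Finset Literature.Combinatorics.Sahi2008

section Plumbing

variable {α : Type*} [Fintype α]

/-- `E` of a pointwise sum (the tree's `ex_add`, lambda form). [folklore] -/
theorem ex_add' (μ f g : α → ℝ) : ex μ (fun x => f x + g x) = ex μ f + ex μ g := ex_add μ f g

/-- `E` of a pointwise difference. [folklore] -/
theorem ex_sub' (μ f g : α → ℝ) : ex μ (fun x => f x - g x) = ex μ f - ex μ g := by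
  simp only [ex, mul_sub, Finset.sum_sub_distrib]

end Plumbing

/-- The product weight of two probability weights has mass one. [folklore] -/
theorem sum_prodWeight {γ β : Type*} [Fintype γ] [Fintype β] (μ : γ → ℝ) (ν : β → ℝ) (hμ1 : ∑ t, μ t = 1) (hν1 : ∑ t, ν t = 1) :
    ∑ p : γ × β, (fun p : γ × β => μ p.1 * ν p.2) p = 1 := by
  have h : ∑ p : γ × β, (fun p : γ × β => μ p.1 * ν p.2) p = (∑ x, μ x) * ∑ y, ν y := by
    rw [Finset.sum_mul_sum, Fintype.sum_prod_type]
  rw [h, hμ1, hν1, one_mul]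

/-- **Fubini for tensor functions**: `E^{μ⊗ν}[f ⊗ g] = E^μ[f]·E^ν[g]`. [folklore] -/
theorem ex_tensor {γ β : Type*} [Fintype γ] [Fintype β] (μ : γ → ℝ) (ν : β → ℝ) (f : γ → ℝ) (g : β → ℝ) (F : γ × β → ℝ)
    (hF : ∀ p, F p = f p.1 * g p.2) : ex (fun p : γ × β => μ p.1 * ν p.2) F = ex μ f * ex ν g := by
  rw [ex_def, ex_def, ex_def, Finset.sum_mul_sum, Fintype.sum_prod_type]
  exact Finset.sum_congr rfl fun x _ => Finset.sum_congr rfl fun y _ => by rw [hF]; ring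

/-- **One-sided dictionary.**  For `[0,1]`-valued functions `a_0,a_1,a_2` under a probability weight `μ`, the fail moments
`E_μ Π_{i∈S} (1 − a_i)` (passed as real variables `x_S` with their defining equations, to keep the statement readable) satisfy the twenty-six
hypotheses of `e3Union_nonneg_of_failMoments`, the three Harris rows `Cov(a_i,a_j) ≥ 0`, the three
hereditary Harris rows `Cov(a_ia_j, a_k) ≥ 0` and Sahi's row `E₃(a_0,a_1,a_2) ≥ 0` being ASSUMED (in their natural "hold" form) and translated
by inclusion–exclusion; all Venn masses are nonnegative because `0 ≤ a_i ≤ 1` pointwise. [this work] -/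
theorem failMoments_facts {γ : Type*} [Fintype γ] (μ : γ → ℝ) (hμ0 : ∀ t, 0 ≤ μ t) (hμ1 : ∑ t, μ t = 1)
    (a : Fin 3 → γ → ℝ) (ha0 : ∀ i t, 0 ≤ a i t) (ha1 : ∀ i t, a i t ≤ 1)
    (hκ01 : ex μ (a 0) * ex μ (a 1) ≤ ex μ (a 0 * a 1)) (hκ02 : ex μ (a 0) * ex μ (a 2) ≤ ex μ (a 0 * a 2))
    (hκ12 : ex μ (a 1) * ex μ (a 2) ≤ ex μ (a 1 * a 2))
    (hρ0 : ex μ (a 1 * a 2) * ex μ (a 0) ≤ ex μ (a 0 * a 1 * a 2)) (hρ1 : ex μ (a 0 * a 2) * ex μ (a 1) ≤ ex μ (a 0 * a 1 * a 2))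
    (hρ2 : ex μ (a 0 * a 1) * ex μ (a 2) ≤ ex μ (a 0 * a 1 * a 2)) (he : 0 ≤ sahiE μ 3 a)
    (x0 x1 x2 x01 x02 x12 x012 : ℝ)
    (d0 : x0 = ex μ (fun t => (1 - a 0 t)))
    (d1 : x1 = ex μ (fun t => (1 - a 1 t)))
    (d2 : x2 = ex μ (fun t => (1 - a 2 t)))
    (d01 : x01 = ex μ (fun t => (1 - a 0 t) * (1 - a 1 t)))
    (d02 : x02 = ex μ (fun t => (1 - a 0 t) * (1 - a 2 t)))
    (d12 : x12 = ex μ (fun t => (1 - a 1 t) * (1 - a 2 t)))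
    (d012 : x012 = ex μ (fun t => (1 - a 0 t) * (1 - a 1 t) * (1 - a 2 t))) :
    (0 ≤ x0) ∧
      (0 ≤ x1) ∧
      (0 ≤ x2) ∧
      (0 ≤ x01) ∧
      (0 ≤ x02) ∧
      (0 ≤ x12) ∧
      (0 ≤ x012) ∧
      (x0 ≤ 1) ∧
      (x1 ≤ 1) ∧
      (x2 ≤ 1) ∧
      (x01 ≤ x0) ∧
      (x01 ≤ x1) ∧
      (x02 ≤ x0) ∧
      (x02 ≤ x2) ∧
      (x12 ≤ x1) ∧
      (x12 ≤ x2) ∧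
      (x012 ≤ x01) ∧
      (x012 ≤ x02) ∧
      (x012 ≤ x12) ∧
      (x0 * x1 ≤ x01) ∧
      (x0 * x2 ≤ x02) ∧
      (x1 * x2 ≤ x12) ∧
      (0 ≤ ((x01 - x0*x1) + (x02 - x0*x2) - (x012 - x12*x0))) ∧
      (0 ≤ ((x01 - x0*x1) + (x12 - x1*x2) - (x012 - x02*x1))) ∧
      (0 ≤ ((x02 - x0*x2) + (x12 - x1*x2) - (x012 - x01*x2))) ∧
      (0 ≤ ((x01 - x0*x1) + (x02 - x0*x2) + (x12 - x1*x2) - (2*x012 - x0*x12 - x1*x02 - x2*x01 + x0*x1*x2))) := by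
  subst d0 d1 d2 d01 d02 d12 d012
  -- pointwise facts
  have p0 : ∀ t, 0 ≤ 1 - a 0 t := fun t => sub_nonneg.2 (ha1 0 t)
  have p1 : ∀ t, 0 ≤ 1 - a 1 t := fun t => sub_nonneg.2 (ha1 1 t)
  have p2 : ∀ t, 0 ≤ 1 - a 2 t := fun t => sub_nonneg.2 (ha1 2 t)
  have q0 : ∀ t, 1 - a 0 t ≤ 1 := fun t => sub_le_self _ (ha0 0 t)
  have q1 : ∀ t, 1 - a 1 t ≤ 1 := fun t => sub_le_self _ (ha0 1 t)
  have q2 : ∀ t, 1 - a 2 t ≤ 1 := fun t => sub_le_self _ (ha0 2 t)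
  -- inclusion–exclusion: fail moments in terms of hold moments
  have i0 : ex μ (fun t => (1 - a 0 t)) = 1 - ex μ (a 0) := by
    rw [ex_sub', ex_const hμ1]
  have i1 : ex μ (fun t => (1 - a 1 t)) = 1 - ex μ (a 1) := by
    rw [ex_sub', ex_const hμ1]
  have i2 : ex μ (fun t => (1 - a 2 t)) = 1 - ex μ (a 2) := by
    rw [ex_sub', ex_const hμ1]
  have i01 : ex μ (fun t => (1 - a 0 t) * (1 - a 1 t)) = 1 - ex μ (a 0) - ex μ (a 1) + ex μ (a 0 * a 1) := by
    rw [show (fun t => (1 - a 0 t) * (1 - a 1 t)) = fun t => (fun _ => (1:ℝ)) t - a 0 t - a 1 t + (a 0 * a 1) t from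
      funext fun t => by simp only [Pi.mul_apply]; ring]
    rw [ex_add', ex_sub', ex_sub', ex_const hμ1]
  have i02 : ex μ (fun t => (1 - a 0 t) * (1 - a 2 t)) = 1 - ex μ (a 0) - ex μ (a 2) + ex μ (a 0 * a 2) := by
    rw [show (fun t => (1 - a 0 t) * (1 - a 2 t)) = fun t => (fun _ => (1:ℝ)) t - a 0 t - a 2 t + (a 0 * a 2) t from
      funext fun t => by simp only [Pi.mul_apply]; ring]
    rw [ex_add', ex_sub', ex_sub', ex_const hμ1]
  have i12 : ex μ (fun t => (1 - a 1 t) * (1 - a 2 t)) = 1 - ex μ (a 1) - ex μ (a 2) + ex μ (a 1 * a 2) := by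
    rw [show (fun t => (1 - a 1 t) * (1 - a 2 t)) = fun t => (fun _ => (1:ℝ)) t - a 1 t - a 2 t + (a 1 * a 2) t from
      funext fun t => by simp only [Pi.mul_apply]; ring]
    rw [ex_add', ex_sub', ex_sub', ex_const hμ1]
  have i012 : ex μ (fun t => (1 - a 0 t) * (1 - a 1 t) * (1 - a 2 t)) = 1 - ex μ (a 0) - ex μ (a 1) - ex μ (a 2) + ex μ (a 0 * a 1)
      + ex μ (a 0 * a 2) + ex μ (a 1 * a 2) - ex μ (a 0 * a 1 * a 2) := by
    rw [show (fun t => (1 - a 0 t) * (1 - a 1 t) * (1 - a 2 t)) = fun t => (fun _ => (1:ℝ)) t - a 0 t - a 1 t - a 2 t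
        + (a 0 * a 1) t + (a 0 * a 2) t + (a 1 * a 2) t - (a 0 * a 1 * a 2) t from
      funext fun t => by simp only [Pi.mul_apply]; ring]
    rw [ex_sub', ex_add', ex_add', ex_add', ex_sub', ex_sub', ex_sub', ex_const hμ1]
  have he' := he
  rw [sahiE_three_apply] at he'
  have hE0 : 0 ≤ ex μ (a 0) := ex_nonneg hμ0 (ha0 0)
  have hE1 : 0 ≤ ex μ (a 1) := ex_nonneg hμ0 (ha0 1)
  have hE2 : 0 ≤ ex μ (a 2) := ex_nonneg hμ0 (ha0 2)
  refine ⟨ex_nonneg hμ0 p0, ex_nonneg hμ0 p1, ex_nonneg hμ0 p2,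
    ex_nonneg hμ0 (fun t => mul_nonneg (p0 t) (p1 t)), ex_nonneg hμ0 (fun t => mul_nonneg (p0 t) (p2 t)),
    ex_nonneg hμ0 (fun t => mul_nonneg (p1 t) (p2 t)),
    ex_nonneg hμ0 (fun t => mul_nonneg (mul_nonneg (p0 t) (p1 t)) (p2 t)),
    by linarith only [i0, hE0], by linarith only [i1, hE1], by linarith only [i2, hE2],
    ex_mono hμ0 (fun t => mul_le_of_le_one_right (p0 t) (q1 t)), ex_mono hμ0 (fun t => mul_le_of_le_one_left (p1 t) (q0 t)),
    ex_mono hμ0 (fun t => mul_le_of_le_one_right (p0 t) (q2 t)), ex_mono hμ0 (fun t => mul_le_of_le_one_left (p2 t) (q0 t)),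
    ex_mono hμ0 (fun t => mul_le_of_le_one_right (p1 t) (q2 t)), ex_mono hμ0 (fun t => mul_le_of_le_one_left (p2 t) (q1 t)),
    ex_mono hμ0 (fun t => mul_le_of_le_one_right (mul_nonneg (p0 t) (p1 t)) (q2 t)),
    ex_mono hμ0 (fun t => ?_), ex_mono hμ0 (fun t => ?_), ?_, ?_, ?_, ?_, ?_, ?_, ?_⟩
  · -- (1-a0)(1-a1)(1-a2) ≤ (1-a0)(1-a2)
    have h := mul_le_of_le_one_right (mul_nonneg (p0 t) (p2 t)) (q1 t)
    nlinarith only [h]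
  · -- (1-a0)(1-a1)(1-a2) ≤ (1-a1)(1-a2)
    have h := mul_le_of_le_one_left (mul_nonneg (p1 t) (p2 t)) (q0 t)
    nlinarith only [h]
  · rw [i0, i1, i01]; nlinarith only [hκ01]
  · rw [i0, i2, i02]; nlinarith only [hκ02]
  · rw [i1, i2, i12]; nlinarith only [hκ12]
  · rw [i0, i1, i2, i01, i02, i12, i012]; nlinarith only [hρ0]
  · rw [i0, i1, i2, i01, i02, i12, i012]; nlinarith only [hρ1]
  · rw [i0, i1, i2, i01, i02, i12, i012]; nlinarith only [hρ2]
  · rw [i0, i1, i2, i01, i02, i12, i012]; nlinarith only [he']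

/-- **Sahi's `E₃` (Kahn's functional) is nonnegative on "probabilistic unions" of two independent triples.**  `μ`, `ν` probability weights on finite
types `γ`, `β`; `a_i : γ → [0,1]`, `b_i : β → [0,1]` (`i < 3`) each satisfying, under its own weight, the Harris rows `Cov(a_i,a_j) ≥ 0`
    , the hereditary
Harris rows `Cov(a_ia_j,a_k) ≥ 0` and Sahi's `E₃(a_0,a_1,a_2) ≥ 0`; then under the product weight `(x,y) ↦ μ(x)ν(y)` the slots
`u_i(x,y) = a_i(x) + b_i(y) − a_i(x)b_i(y)` (`= 1_{A_i × β ∪ γ × B_i}` for indicators) have `E₃(u_0,u_1,u_2) ≥ 0`.  Proof: the seven joint moments of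
the `u_i` are `1 − x_iy_i`, `1 − x_iy_i − x_jy_j + x_{ij}y_{ij}`, … in the fail moments, and `e3Union_nonneg_of_failMoments` applies via
`failMoments_facts`. [this work] -/
theorem sahiE_three_por_nonneg {γ β : Type*} [Fintype γ] [Fintype β] (μ : γ → ℝ) (ν : β → ℝ)
    (hμ0 : ∀ t, 0 ≤ μ t) (hμ1 : ∑ t, μ t = 1) (hν0 : ∀ t, 0 ≤ ν t) (hν1 : ∑ t, ν t = 1)
    (a : Fin 3 → γ → ℝ) (b : Fin 3 → β → ℝ) (ha0 : ∀ i t, 0 ≤ a i t) (ha1 : ∀ i t, a i t ≤ 1) (hb0 : ∀ i t, 0 ≤ b i t) (hb1 : ∀ i t, b i t ≤ 1)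
    (hκ01 : ex μ (a 0) * ex μ (a 1) ≤ ex μ (a 0 * a 1)) (hκ02 : ex μ (a 0) * ex μ (a 2) ≤ ex μ (a 0 * a 2)) (hκ12 : ex μ (a 1) * ex μ (a 2)
        ≤ ex μ (a 1 * a 2))
    (hρ0 : ex μ (a 1 * a 2) * ex μ (a 0) ≤ ex μ (a 0 * a 1 * a 2)) (hρ1 : ex μ (a 0 * a 2) * ex μ (a 1)
        ≤ ex μ (a 0 * a 1 * a 2)) (hρ2 : ex μ (a 0 * a 1) * ex μ (a 2) ≤ ex μ (a 0 * a 1 * a 2))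
    (hea : 0 ≤ sahiE μ 3 a)
    (hL01 : ex ν (b 0) * ex ν (b 1) ≤ ex ν (b 0 * b 1)) (hL02 : ex ν (b 0) * ex ν (b 2) ≤ ex ν (b 0 * b 2)) (hL12 : ex ν (b 1) * ex ν (b 2)
        ≤ ex ν (b 1 * b 2))
    (hσ0 : ex ν (b 1 * b 2) * ex ν (b 0) ≤ ex ν (b 0 * b 1 * b 2)) (hσ1 : ex ν (b 0 * b 2) * ex ν (b 1)
        ≤ ex ν (b 0 * b 1 * b 2)) (hσ2 : ex ν (b 0 * b 1) * ex ν (b 2) ≤ ex ν (b 0 * b 1 * b 2))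
    (heb : 0 ≤ sahiE ν 3 b) :
    0 ≤ sahiE (fun p : γ × β => μ p.1 * ν p.2) 3 (fun (i : Fin 3) (p : γ × β) => a i p.1 + b i p.2 - a i p.1 * b i p.2) := by
  obtain ⟨hx0, hx1, hx2, -, -, -, -, hx0', hx1', hx2', h010, h011, h020, h022, h121, h122, h01, h02, h12, hk01, hk02, hk12,
    hr0, hr1, hr2, heA⟩ := failMoments_facts μ hμ0 hμ1 a ha0 ha1 hκ01 hκ02 hκ12 hρ0 hρ1 hρ2 hea _ _ _ _ _ _ _ rfl rfl rfl rfl rfl rfl rfl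
  obtain ⟨hy0, hy1, hy2, hy01, hy02, hy12, hy012, -, -, -, -, -, -, -, -, -, hd2', hd1', hd0', hl01, hl02, hl12,
    hs0, hs1, hs2, heB⟩ := failMoments_facts ν hν0 hν1 b hb0 hb1 hL01 hL02 hL12 hσ0 hσ1 hσ2 heb _ _ _ _ _ _ _ rfl rfl rfl rfl rfl rfl rfl
  have hW1 : ∑ p : γ × β, (fun p : γ × β => μ p.1 * ν p.2) p = 1 := sum_prodWeight μ ν hμ1 hν1
  -- tensor moments `E[Π_S (1-a_i) ⊗ Π_S (1-b_i)] = x_S y_S`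
  have g0 : ex (fun p : γ × β => μ p.1 * ν p.2) (fun p : γ × β => (1 - a 0 p.1) * (1 - b 0 p.2)) = ex μ (fun t => (1 - a 0 t)) * ex ν (fun t => (1
      - b 0 t)) := ex_tensor μ ν (fun t => (1 - a 0 t)) (fun t => (1 - b 0 t)) _ fun p => rfl
  have g1 : ex (fun p : γ × β => μ p.1 * ν p.2) (fun p : γ × β => (1 - a 1 p.1) * (1 - b 1 p.2)) = ex μ (fun t => (1 - a 1 t)) * ex ν (fun t => (1
      - b 1 t)) := ex_tensor μ ν (fun t => (1 - a 1 t)) (fun t => (1 - b 1 t)) _ fun p => rfl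
  have g2 : ex (fun p : γ × β => μ p.1 * ν p.2) (fun p : γ × β => (1 - a 2 p.1) * (1 - b 2 p.2)) = ex μ (fun t => (1 - a 2 t)) * ex ν (fun t => (1
      - b 2 t)) := ex_tensor μ ν (fun t => (1 - a 2 t)) (fun t => (1 - b 2 t)) _ fun p => rfl
  have g01 : ex (fun p : γ × β => μ p.1 * ν p.2) (fun p : γ × β => ((1 - a 0 p.1) * (1 - a 1 p.1)) * ((1 - b 0 p.2) * (1 - b 1 p.2)))
      = ex μ (fun t => (1 - a 0 t) * (1 - a 1 t)) * ex ν (fun t => (1 - b 0 t) * (1 - b 1 t)) := ex_tensor μ ν (fun t => (1 - a 0 t) * (1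
      - a 1 t)) (fun t => (1 - b 0 t) * (1 - b 1 t)) _ fun p => rfl
  have g02 : ex (fun p : γ × β => μ p.1 * ν p.2) (fun p : γ × β => ((1 - a 0 p.1) * (1 - a 2 p.1)) * ((1 - b 0 p.2) * (1 - b 2 p.2)))
      = ex μ (fun t => (1 - a 0 t) * (1 - a 2 t)) * ex ν (fun t => (1 - b 0 t) * (1 - b 2 t)) := ex_tensor μ ν (fun t => (1 - a 0 t) * (1
      - a 2 t)) (fun t => (1 - b 0 t) * (1 - b 2 t)) _ fun p => rfl
  have g12 : ex (fun p : γ × β => μ p.1 * ν p.2) (fun p : γ × β => ((1 - a 1 p.1) * (1 - a 2 p.1)) * ((1 - b 1 p.2) * (1 - b 2 p.2)))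
      = ex μ (fun t => (1 - a 1 t) * (1 - a 2 t)) * ex ν (fun t => (1 - b 1 t) * (1 - b 2 t)) := ex_tensor μ ν (fun t => (1 - a 1 t) * (1
      - a 2 t)) (fun t => (1 - b 1 t) * (1 - b 2 t)) _ fun p => rfl
  have g012 : ex (fun p : γ × β => μ p.1 * ν p.2) (fun p : γ × β => ((1 - a 0 p.1) * (1 - a 1 p.1) * (1 - a 2 p.1)) * ((1 - b 0 p.2) * (1
      - b 1 p.2) * (1 - b 2 p.2))) = ex μ (fun t => (1 - a 0 t) * (1 - a 1 t) * (1 - a 2 t)) * ex ν (fun t => (1 - b 0 t) * (1 - b 1 t) * (1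
      - b 2 t)) := ex_tensor μ ν (fun t => (1 - a 0 t) * (1 - a 1 t) * (1 - a 2 t)) (fun t => (1 - b 0 t) * (1 - b 1 t) * (1 - b 2 t)) _ fun p => rfl
  -- the seven joint moments of the slots
  have m0 : ex (fun p : γ × β => μ p.1 * ν p.2) ((fun (i : Fin 3) (p : γ × β) => a i p.1 + b i p.2 - a i p.1 * b i p.2) 0) = 1 - ex μ (fun t => (1
      - a 0 t)) * ex ν (fun t => (1 - b 0 t)) := by
    rw [show (fun (i : Fin 3) (p : γ × β) => a i p.1 + b i p.2 - a i p.1 * b i p.2) 0 = fun p => (fun _ => (1:ℝ)) p - (fun p : γ × β => (1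
        - a 0 p.1) * (1 - b 0 p.2)) p from funext fun p => by ring]
    rw [ex_sub', ex_const hW1, g0]
  have m1 : ex (fun p : γ × β => μ p.1 * ν p.2) ((fun (i : Fin 3) (p : γ × β) => a i p.1 + b i p.2 - a i p.1 * b i p.2) 1) = 1 - ex μ (fun t => (1
      - a 1 t)) * ex ν (fun t => (1 - b 1 t)) := by
    rw [show (fun (i : Fin 3) (p : γ × β) => a i p.1 + b i p.2 - a i p.1 * b i p.2) 1 = fun p => (fun _ => (1:ℝ)) p - (fun p : γ × β => (1
        - a 1 p.1) * (1 - b 1 p.2)) p from funext fun p => by ring]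
    rw [ex_sub', ex_const hW1, g1]
  have m2 : ex (fun p : γ × β => μ p.1 * ν p.2) ((fun (i : Fin 3) (p : γ × β) => a i p.1 + b i p.2 - a i p.1 * b i p.2) 2) = 1 - ex μ (fun t => (1
      - a 2 t)) * ex ν (fun t => (1 - b 2 t)) := by
    rw [show (fun (i : Fin 3) (p : γ × β) => a i p.1 + b i p.2 - a i p.1 * b i p.2) 2 = fun p => (fun _ => (1:ℝ)) p - (fun p : γ × β => (1
        - a 2 p.1) * (1 - b 2 p.2)) p from funext fun p => by ring]
    rw [ex_sub', ex_const hW1, g2]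
  have m01 : ex (fun p : γ × β => μ p.1 * ν p.2) ((fun (i : Fin 3) (p : γ × β) => a i p.1 + b i p.2
      - a i p.1 * b i p.2) 0 * (fun (i : Fin 3) (p : γ × β) => a i p.1 + b i p.2 - a i p.1 * b i p.2) 1) = 1 - ex μ (fun t => (1 - a 0 t))
      * ex ν (fun t => (1 - b 0 t)) - ex μ (fun t => (1 - a 1 t)) * ex ν (fun t => (1 - b 1 t)) + ex μ (fun t => (1 - a 0 t) * (1 - a 1 t))
      * ex ν (fun t => (1 - b 0 t) * (1 - b 1 t)) := by
    rw [show (fun (i : Fin 3) (p : γ × β) => a i p.1 + b i p.2 - a i p.1 * b i p.2) 0 * (fun (i : Fin 3) (p : γ × β) => a i p.1 + b i p.2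
        - a i p.1 * b i p.2) 1 = fun p => (fun _ => (1:ℝ)) p - (fun p : γ × β => (1 - a 0 p.1) * (1 - b 0 p.2)) p - (fun p : γ × β => (1
        - a 1 p.1) * (1 - b 1 p.2)) p + (fun p : γ × β => ((1 - a 0 p.1) * (1 - a 1 p.1)) * ((1 - b 0 p.2) * (1 - b 1 p.2))) p from
      funext fun p => by simp only [Pi.mul_apply]; ring]
    rw [ex_add', ex_sub', ex_sub', ex_const hW1, g0, g1, g01]
  have m02 : ex (fun p : γ × β => μ p.1 * ν p.2) ((fun (i : Fin 3) (p : γ × β) => a i p.1 + b i p.2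
      - a i p.1 * b i p.2) 0 * (fun (i : Fin 3) (p : γ × β) => a i p.1 + b i p.2 - a i p.1 * b i p.2) 2) = 1 - ex μ (fun t => (1 - a 0 t))
      * ex ν (fun t => (1 - b 0 t)) - ex μ (fun t => (1 - a 2 t)) * ex ν (fun t => (1 - b 2 t)) + ex μ (fun t => (1 - a 0 t) * (1 - a 2 t))
      * ex ν (fun t => (1 - b 0 t) * (1 - b 2 t)) := by
    rw [show (fun (i : Fin 3) (p : γ × β) => a i p.1 + b i p.2 - a i p.1 * b i p.2) 0 * (fun (i : Fin 3) (p : γ × β) => a i p.1 + b i p.2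
        - a i p.1 * b i p.2) 2 = fun p => (fun _ => (1:ℝ)) p - (fun p : γ × β => (1 - a 0 p.1) * (1 - b 0 p.2)) p - (fun p : γ × β => (1
        - a 2 p.1) * (1 - b 2 p.2)) p + (fun p : γ × β => ((1 - a 0 p.1) * (1 - a 2 p.1)) * ((1 - b 0 p.2) * (1 - b 2 p.2))) p from
      funext fun p => by simp only [Pi.mul_apply]; ring]
    rw [ex_add', ex_sub', ex_sub', ex_const hW1, g0, g2, g02]
  have m12 : ex (fun p : γ × β => μ p.1 * ν p.2) ((fun (i : Fin 3) (p : γ × β) => a i p.1 + b i p.2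
      - a i p.1 * b i p.2) 1 * (fun (i : Fin 3) (p : γ × β) => a i p.1 + b i p.2 - a i p.1 * b i p.2) 2) = 1 - ex μ (fun t => (1 - a 1 t))
      * ex ν (fun t => (1 - b 1 t)) - ex μ (fun t => (1 - a 2 t)) * ex ν (fun t => (1 - b 2 t)) + ex μ (fun t => (1 - a 1 t) * (1 - a 2 t))
      * ex ν (fun t => (1 - b 1 t) * (1 - b 2 t)) := by
    rw [show (fun (i : Fin 3) (p : γ × β) => a i p.1 + b i p.2 - a i p.1 * b i p.2) 1 * (fun (i : Fin 3) (p : γ × β) => a i p.1 + b i p.2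
        - a i p.1 * b i p.2) 2 = fun p => (fun _ => (1:ℝ)) p - (fun p : γ × β => (1 - a 1 p.1) * (1 - b 1 p.2)) p - (fun p : γ × β => (1
        - a 2 p.1) * (1 - b 2 p.2)) p + (fun p : γ × β => ((1 - a 1 p.1) * (1 - a 2 p.1)) * ((1 - b 1 p.2) * (1 - b 2 p.2))) p from
      funext fun p => by simp only [Pi.mul_apply]; ring]
    rw [ex_add', ex_sub', ex_sub', ex_const hW1, g1, g2, g12]
  have m012 : ex (fun p : γ × β => μ p.1 * ν p.2) ((fun (i : Fin 3) (p : γ × β) => a i p.1 + b i p.2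
      - a i p.1 * b i p.2) 0 * (fun (i : Fin 3) (p : γ × β) => a i p.1 + b i p.2 - a i p.1 * b i p.2) 1 * (fun (i : Fin 3) (p : γ × β) => a i p.1
      + b i p.2 - a i p.1 * b i p.2) 2)
      = 1 - (ex μ (fun t => (1 - a 0 t)) * ex ν (fun t => (1 - b 0 t)) + ex μ (fun t => (1 - a 1 t)) * ex ν (fun t => (1 - b 1 t))
          + ex μ (fun t => (1 - a 2 t)) * ex ν (fun t => (1 - b 2 t)))
        + (ex μ (fun t => (1 - a 0 t) * (1 - a 1 t)) * ex ν (fun t => (1 - b 0 t) * (1 - b 1 t)) + ex μ (fun t => (1 - a 0 t) * (1 - a 2 t))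
            * ex ν (fun t => (1 - b 0 t) * (1 - b 2 t)) + ex μ (fun t => (1 - a 1 t) * (1 - a 2 t)) * ex ν (fun t => (1 - b 1 t) * (1 - b 2 t)))
            - ex μ (fun t => (1 - a 0 t) * (1 - a 1 t) * (1 - a 2 t)) * ex ν (fun t => (1 - b 0 t) * (1 - b 1 t) * (1 - b 2 t)) := by
    rw [show (fun (i : Fin 3) (p : γ × β) => a i p.1 + b i p.2 - a i p.1 * b i p.2) 0 * (fun (i : Fin 3) (p : γ × β) => a i p.1 + b i p.2
        - a i p.1 * b i p.2) 1 * (fun (i : Fin 3) (p : γ × β) => a i p.1 + b i p.2 - a i p.1 * b i p.2) 2 = fun p => (fun _ => (1:ℝ)) p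
        - ((fun p : γ × β => (1 - a 0 p.1) * (1 - b 0 p.2)) p + (fun p : γ × β => (1 - a 1 p.1) * (1 - b 1 p.2)) p + (fun p : γ × β => (1
        - a 2 p.1) * (1 - b 2 p.2)) p)
        + ((fun p : γ × β => ((1 - a 0 p.1) * (1 - a 1 p.1)) * ((1 - b 0 p.2) * (1 - b 1 p.2))) p + (fun p : γ × β => ((1 - a 0 p.1) * (1
            - a 2 p.1)) * ((1 - b 0 p.2) * (1 - b 2 p.2))) p + (fun p : γ × β => ((1 - a 1 p.1) * (1 - a 2 p.1)) * ((1 - b 1 p.2) * (1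
            - b 2 p.2))) p) - (fun p : γ × β => ((1 - a 0 p.1) * (1 - a 1 p.1) * (1 - a 2 p.1)) * ((1 - b 0 p.2) * (1 - b 1 p.2) * (1
            - b 2 p.2))) p from
      funext fun p => by simp only [Pi.mul_apply]; ring]
    rw [ex_sub', ex_add', ex_sub', ex_const hW1, ex_add', ex_add', ex_add', ex_add', g0, g1, g2, g01, g02, g12, g012]
  rw [sahiE_three_apply, m012, m0, m1, m2, m12, m02, m01]
  exact e3Union_nonneg_of_failMoments _ _ _ _ _ _ _ _ _ _ _ _ _ _ hx0 hx1 hx2 hx0' hx1' hx2' h010 h011 h020 h022 h121 h122 h01 h02 h12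
    hk01 hk02 hk12 hr0 hr1 hr2 heA hy0 hy1 hy2 hy01 hy02 hy12 hy012 hd0' hd1' hd2' hl01 hl02 hl12 hs0 hs1 hs2 heB

end Summit.CriticalPhenomena.PercolationContinuityZ3.Theorems.SahiE3UnionTensor
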